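import Summits.ValiantsHypothesis.ValiantsHypothesis.Theses.SymmetroidDescartes
import Summits.ValiantsHypothesis.ValiantsHypothesis.Theorems.DerivedPencilRolle.Negative.DerivedPencilRolleFalseOfTriangularClassManyRoots

/-!
# `DerivedPencilRolleQuasi` — negative lemma: the crux bounds the sign alternations of EVERY real
# lacunary matrix pencil (no symmetry, no invertibility, no Rolle term)

Crux `stmt-ValiantsHypothesis-18064` (`Theses.SymmetroidDescartes.DerivedPencilRolleQuasi`, route
SymmetroidDescartes): `∃ C A, ∀ m K S d` (real symmetric invertible coefficients, `d` strictly increasing),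
`Z₊(det F) ≤ C · Z₊(det ∂F) + (K+1)^(A·K) · 2^((log₂ m + 2)^A)`.

Refuter crux-attack g2 (2026-08-17).  Everything here is sorry-free; nothing asserts a route statement
positively (Negative/ lane, `--supports stmt-ValiantsHypothesis-18064`).

## The block embedding

Let `G(t) = Σ_{l ≤ K} t^{d_l} A_l` be ANY real `n × n` lacunary matrix pencil (`d 0 = 0`, `d` strictly
increasing; the `A_l` arbitrary).  For `ε > 0` put
`T_l = [[ε·1, A_l], [δ_l·1, ε·1]]` (`δ_0 = 1`, `δ_l = 0` for `l ≥ 1`), a `2n × 2n` pencil `P_ε = Σ t^{d_l} T_l`.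
Then `T_l` (`l ≥ 1`) is upper triangular with positive diagonal, so `P_ε` lies in the tree's TRIANGULAR
CLASS (`DerivedPencilRolleFalseOfTriangularClassManyRoots`: after the symmetrisation `[[0,T],[Tᵀ,c·1]]` the
derived determinant never vanishes on `(0,∞)`, the Rolle multiplier `C` is idle), and
`det P_ε(t) = det((ε·s(t))²·1 − G(t))`, `s(t) = Σ_l t^{d_l}` (`det_fromBlocks_smul_one_one`), which has the
sign of `det(−G(t))` for `ε` small — uniformly at any finite set of test points — while `det T_0 =
charpoly(A_0)(ε²) ≠ 0` off a finite set of `ε`.  Hence: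

* `alternations_le_of_quasiPencilBound` : the crux at constants `(C, A)` and size `4n` bounds the number
  `N` of strict sign alternations of `det G` along ANY increasing positive test sequence by
  `(K+1)^(A·K) · 2^((log₂(4n)+2)^A)` — for every real pencil `G`, symmetric or not, invertible or not.
* `generalPencil_alternations_le_of_derivedPencilRolleQuasi` : packaged against the route decl.
* `derivedPencilRolleQuasi_false_of_generalPencilManyAlternations` : KILL CRITERION — any family of real
  square lacunary pencils whose determinants alternate in sign more than `(K+1)^(A·K)·2^((log₂(4n)+2)^A)`
  times on `(0,∞)`, for every `A`, refutes the crux (`GeneralPencilManyAlternations → ¬ crux`).  The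
  status of `GeneralPencilManyAlternations` is OPEN (it is the disprover's target, not a claim): its
  tropical instances are exactly PARAMETRIC ASSIGNMENT problems (max-weight perfect matchings with edge
  weights `a_e + d_{c(e)}·u`, `K+1` slope classes) with many sign-coherent breakpoints, lifted by Viro
  dominance — a class NOT covered by the Gusfield/Carstensen `s^{O(log s)}` cap on parametric shortest
  PATHS that bounds every family previously on file (staircase, tropical bumps).

[folklore] for the linear algebra; the embedding/limiting argument is this seat's.
-/

-- `Summit.ValiantsHypothesis.ValiantsHypothesis.…` repeats a component by the D-0017 layout.
set_option linter.dupNamespace false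

namespace Summit.ValiantsHypothesis.ValiantsHypothesis.Theorems.DerivedPencilRolleQuasi.Negative

open Summit.ValiantsHypothesis.ValiantsHypothesis.Theses.SymmetroidDescartes
open Summit.ValiantsHypothesis.ValiantsHypothesis.Theorems.SymmetroidDescartes (eval_det_pencil
  card_filter_roots_det_sum_fin_zero le_card_posRoots_of_alternating)
open Summit.ValiantsHypothesis.ValiantsHypothesis.Theorems.DerivedPencilRolle.Negative
open scoped BigOperators Matrix
open Polynomial

/-! ## The crux at fixed constants; the Rolle multiplier is idle on the triangular class -/

/-- The crux `DerivedPencilRolleQuasi` at fixed constants `(C, A)` and fixed size `m`. -/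
def QuasiPencilBound (C A m : ℕ) : Prop :=
  ∀ (K : ℕ) (S : Fin (K + 1) → Matrix (Fin m) (Fin m) ℝ) (d : Fin (K + 1) → ℕ), (∀ l, (S l).IsSymm) →
    (∀ l, (S l).det ≠ 0) → StrictMono d →
      ((∑ l, (Polynomial.X : Polynomial ℝ) ^ d l • (S l).map Polynomial.C).det.roots.toFinset.filter
          (fun t => 0 < t)).card ≤
        C * ((∑ l : Fin K, (Polynomial.X : Polynomial ℝ) ^ (d l.succ - d 0 - 1) •
          (((d l.succ - d 0 : ℕ) : ℝ) • S l.succ).map Polynomial.C).det.roots.toFinset.filter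
            (fun t => 0 < t)).card + (K + 1) ^ (A * K) * 2 ^ (Nat.log 2 m + 2) ^ A

/-- The crux is `∃ C A, ∀ m, QuasiPencilBound C A m` (definitionally). -/
theorem derivedPencilRolleQuasi_iff :
    DerivedPencilRolleQuasi ↔ ∃ C A : ℕ, ∀ m, QuasiPencilBound C A m := Iff.rfl

/-- **C is idle on the triangular class (quasi budget).** At fixed constants, `QuasiPencilBound C A (k+k)`
forces the ABSOLUTE bound `Z₊(det P) ≤ (K+1)^(A·K)·2^((log₂(k+k)+2)^A)` for every member
`P = Σ X^{d l} • T l` of the triangular class (`T 0` invertible, `T l` upper triangular with positive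
diagonal for `l ≥ 1`, `d 0 = 0`) — verbatim port of the tree's `triangular_bound_of_pencilBound`. -/
theorem triangular_quasiBound_of_quasiPencilBound (C A k K : ℕ)
    (T : Fin (K + 1) → Matrix (Fin k) (Fin k) ℝ) (d : Fin (K + 1) → ℕ) (hd0 : d 0 = 0)
    (hd : StrictMono d) (h0 : (T 0).det ≠ 0) (htri : ∀ l : Fin K, (T l.succ).BlockTriangular id)
    (hpos : ∀ (l : Fin K) (i : Fin k), 0 < T l.succ i i) (h : QuasiPencilBound C A (k + k)) :
    ((∑ l, (X : ℝ[X]) ^ d l • (T l).map Polynomial.C).det.roots.toFinset.filter (fun t => 0 < t)).card ≤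
      (K + 1) ^ (A * K) * 2 ^ (Nat.log 2 (k + k) + 2) ^ A := by
  -- the crux instance at the symmetrised pencil
  have hinst := h K (symS T) d (symS_isSymm T) (symS_det_ne_zero T h0 htri hpos) hd
  -- the derived term vanishes
  have hder : ((∑ l : Fin K, (X : ℝ[X]) ^ (d l.succ - d 0 - 1) •
      (((d l.succ - d 0 : ℕ) : ℝ) • symS T l.succ).map Polynomial.C).det.roots.toFinset.filter
        (fun t => 0 < t)).card = 0 := by
    rcases Nat.eq_zero_or_pos K with hK | hK
    · subst hK
      exact card_filter_roots_det_sum_fin_zero _ _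
    · rw [Finset.card_eq_zero, Finset.filter_eq_empty_iff]
      intro t ht hpos_t
      rw [Multiset.mem_toFinset] at ht
      exact eval_det_derived_symS_ne_zero T d hd htri hpos hK t hpos_t (mem_roots'.1 ht).2
  rw [hder, mul_zero, zero_add] at hinst
  -- the symmetrised determinant has at least the positive roots of `det P`
  refine le_trans (Finset.card_le_card fun t ht => ?_) hinst
  rw [Finset.mem_filter, Multiset.mem_toFinset] at ht ⊢
  obtain ⟨ht, htpos⟩ := ht
  have hPne := (mem_roots'.1 ht).1
  have hProot := (mem_roots'.1 ht).2
  refine ⟨mem_roots'.2 ⟨?_, ?_⟩, htpos⟩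
  · -- `det F ≠ 0`: otherwise `det P` would vanish at every real point
    intro hF
    apply hPne
    refine eq_zero_of_infinite_isRoot _ (Set.infinite_of_forall_exists_gt fun s => ⟨s + 1, ?_, by linarith⟩)
    have hev := congrArg (Polynomial.eval (s + 1)) hF
    rw [eval_det_symS T d hd0, Polynomial.eval_zero] at hev
    have hsq : (∑ l, (s + 1) ^ d l • T l).det = 0 := by
      have := (mul_eq_zero.1 hev).resolve_left (pow_ne_zero _ (by norm_num))
      exact pow_eq_zero_iff (n := 2) (by norm_num) |>.1 this
    show IsRoot _ _
    rw [IsRoot.def, eval_det_pencil]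
    exact hsq
  · rw [IsRoot.def, eval_det_symS T d hd0]
    rw [IsRoot.def, eval_det_pencil] at hProot
    rw [hProot]
    ring

/-! ## The block embedding `[[ε·1, A], [δ·1, ε·1]]` -/

section Embedding

variable {n K : ℕ}

/-- `det [[a·1, B], [1, a·1]] = det(a²·1 − B)` for `a ≠ 0` (scale out `a`, then Schur). [folklore] -/
theorem det_fromBlocks_smul_one_one (a : ℝ) (ha : a ≠ 0) (B : Matrix (Fin n) (Fin n) ℝ) :
    (Matrix.fromBlocks (a • (1 : Matrix (Fin n) (Fin n) ℝ)) B 1 (a • 1)).det =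
      (Matrix.scalar (Fin n) (a ^ 2) - B).det := by
  have h1 : Matrix.fromBlocks (a • (1 : Matrix (Fin n) (Fin n) ℝ)) B 1 (a • 1) =
      a • Matrix.fromBlocks 1 (a⁻¹ • B) (a⁻¹ • (1 : Matrix (Fin n) (Fin n) ℝ)) 1 := by
    rw [Matrix.fromBlocks_smul, smul_smul, smul_smul, mul_inv_cancel₀ ha, one_smul, one_smul]
  have h2 : Matrix.scalar (Fin n) (a ^ 2) - B =
      (a ^ 2) • ((1 : Matrix (Fin n) (Fin n) ℝ) - (a⁻¹ * a⁻¹) • B) := by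
    rw [smul_sub, Matrix.scalar_apply, ← Matrix.smul_one_eq_diagonal, smul_smul]
    have : a ^ 2 * (a⁻¹ * a⁻¹) = 1 := by field_simp
    rw [this, one_smul]
  rw [h1, h2, Matrix.det_smul, Matrix.det_smul, Matrix.det_fromBlocks_one₁₁, Fintype.card_sum,
    Fintype.card_fin]
  congr 1
  · ring
  · congr 1
    rw [Matrix.smul_mul, Matrix.one_mul, smul_smul]

/-- the block coefficients `[[ε·1, A l], [δ l·1, ε·1]]` (`δ 0 = 1`, `δ l = 0` for `l ≥ 1`) -/
def eblk (ε : ℝ) (A : Fin (K + 1) → Matrix (Fin n) (Fin n) ℝ) (l : Fin (K + 1)) :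
    Matrix (Fin n ⊕ Fin n) (Fin n ⊕ Fin n) ℝ :=
  Matrix.fromBlocks (ε • (1 : Matrix (Fin n) (Fin n) ℝ)) (A l) (δ l • (1 : Matrix (Fin n) (Fin n) ℝ))
    (ε • (1 : Matrix (Fin n) (Fin n) ℝ))

/-- the embedded coefficients, reindexed to `Fin (n + n)` -/
def embT (ε : ℝ) (A : Fin (K + 1) → Matrix (Fin n) (Fin n) ℝ) (l : Fin (K + 1)) :
    Matrix (Fin (n + n)) (Fin (n + n)) ℝ :=
  Matrix.reindex (e2 n) (e2 n) (eblk ε A l)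

/-- the left copy sits at positions `< n` -/
theorem e2_inl_val (i : Fin n) : ((e2 n (Sum.inl i) : Fin (n + n)) : ℕ) = i := by
  simp [e2]

/-- the right copy sits at positions `≥ n` -/
theorem e2_inr_val (i : Fin n) : ((e2 n (Sum.inr i) : Fin (n + n)) : ℕ) = n + i := by
  simp [e2, Nat.add_comm]

/-- For `l ≥ 1` the embedded coefficient is upper triangular … -/
theorem embT_succ_blockTriangular (ε : ℝ) (A : Fin (K + 1) → Matrix (Fin n) (Fin n) ℝ) (l : Fin K) :
    (embT ε A l.succ).BlockTriangular id := by
  intro i j hij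
  simp only [id] at hij
  unfold embT eblk
  have hδ : δ (Fin.succ l) = 0 := by simp [δ, Fin.succ_ne_zero]
  rw [hδ, zero_smul]
  simp only [Matrix.reindex_apply, Matrix.submatrix_apply]
  -- write `i = e2 n x`, `j = e2 n y`
  obtain ⟨x, rfl⟩ := (e2 n).surjective i
  obtain ⟨y, rfl⟩ := (e2 n).surjective j
  simp only [Equiv.symm_apply_apply]
  rcases x with x | x <;> rcases y with y | y
  · simp only [Matrix.fromBlocks_apply₁₁, Matrix.smul_apply, smul_eq_mul]
    have hne : x ≠ y := by
      rintro rfl; exact lt_irrefl _ hij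
    simp [Matrix.one_apply_ne hne]
  · exfalso
    have h1 := e2_inl_val (n := n) x
    have h2 := e2_inr_val (n := n) y
    have : ((e2 n (Sum.inr y) : Fin (n + n)) : ℕ) < ((e2 n (Sum.inl x) : Fin (n + n)) : ℕ) := hij
    omega
  · simp [Matrix.fromBlocks_apply₂₁]
  · simp only [Matrix.fromBlocks_apply₂₂, Matrix.smul_apply, smul_eq_mul]
    have hne : x ≠ y := by
      rintro rfl; exact lt_irrefl _ hij
    simp [Matrix.one_apply_ne hne]

/-- … with diagonal entries `ε`. -/
theorem embT_succ_diag (ε : ℝ) (A : Fin (K + 1) → Matrix (Fin n) (Fin n) ℝ) (l : Fin K)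
    (i : Fin (n + n)) : embT ε A l.succ i i = ε := by
  unfold embT eblk
  simp only [Matrix.reindex_apply, Matrix.submatrix_apply]
  obtain ⟨x, rfl⟩ := (e2 n).surjective i
  simp only [Equiv.symm_apply_apply]
  rcases x with x | x
  · simp [Matrix.fromBlocks_apply₁₁]
  · simp [Matrix.fromBlocks_apply₂₂]

/-- `det T_0 = det(ε²·1 − A_0) = charpoly(A_0)(ε²)` for `ε ≠ 0`. -/
theorem det_embT_zero (ε : ℝ) (hε : ε ≠ 0) (A : Fin (K + 1) → Matrix (Fin n) (Fin n) ℝ) :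
    (embT ε A 0).det = (A 0).charpoly.eval (ε ^ 2) := by
  unfold embT eblk
  rw [Matrix.det_reindex_self]
  have hδ : δ (0 : Fin (K + 1)) = 1 := by simp [δ]
  rw [hδ, one_smul, det_fromBlocks_smul_one_one ε hε, Matrix.eval_charpoly]

/-- A weighted sum of the embedded blocks is the embedded block of the weighted sums. -/
theorem sum_smul_embT (ε : ℝ) (A : Fin (K + 1) → Matrix (Fin n) (Fin n) ℝ) (c : Fin (K + 1) → ℝ) :
    ∑ l, c l • embT ε A l =
      Matrix.reindex (e2 n) (e2 n) (Matrix.fromBlocks ((ε * ∑ l, c l) • (1 : Matrix (Fin n) (Fin n) ℝ))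
        (∑ l, c l • A l) ((∑ l, c l * δ l) • (1 : Matrix (Fin n) (Fin n) ℝ))
        ((ε * ∑ l, c l) • (1 : Matrix (Fin n) (Fin n) ℝ))) := by
  have h : ∑ l, c l • eblk ε A l =
      Matrix.fromBlocks ((ε * ∑ l, c l) • (1 : Matrix (Fin n) (Fin n) ℝ))
        (∑ l, c l • A l) ((∑ l, c l * δ l) • (1 : Matrix (Fin n) (Fin n) ℝ))
        ((ε * ∑ l, c l) • (1 : Matrix (Fin n) (Fin n) ℝ)) := by
    unfold eblk
    rw [sum_smul_fromBlocks]
    congr 1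
    · rw [Finset.mul_sum, Finset.sum_smul]
      refine Finset.sum_congr rfl fun l _ => ?_
      rw [smul_smul, mul_comm]
    · rw [Finset.sum_smul]
      refine Finset.sum_congr rfl fun l _ => ?_
      rw [smul_smul]
    · rw [Finset.mul_sum, Finset.sum_smul]
      refine Finset.sum_congr rfl fun l _ => ?_
      rw [smul_smul, mul_comm]
  rw [← h]
  unfold embT
  ext x y
  simp [Matrix.sum_apply]

/-- Evaluating the embedded pencil: `det P_ε(t) = det((ε·s(t))²·1 − G(t))`, `s(t) = Σ_l t^{d_l}`. -/
theorem eval_det_embT (ε : ℝ) (A : Fin (K + 1) → Matrix (Fin n) (Fin n) ℝ) (d : Fin (K + 1) → ℕ)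
    (hd0 : d 0 = 0) (t : ℝ) (hne : ε * ∑ l, t ^ d l ≠ 0) :
    ((∑ l, (X : ℝ[X]) ^ d l • (embT ε A l).map Polynomial.C).det).eval t =
      (Matrix.scalar (Fin n) ((ε * ∑ l, t ^ d l) ^ 2) - ∑ l, t ^ d l • A l).det := by
  rw [eval_det_pencil, sum_smul_embT, Matrix.det_reindex_self]
  have hone : (∑ i : Fin (K + 1), t ^ d i * δ i) = 1 := by
    rw [Finset.sum_eq_single (0 : Fin (K + 1))]
    · simp [hd0, δ]
    · intro b _ hb
      simp [hb, δ]
    · simp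
  rw [hone, one_smul]
  exact det_fromBlocks_smul_one_one _ hne _

end Embedding

/-! ## The main reduction: the crux bounds the alternations of every real lacunary pencil -/

/-- sign coherence from a positive product: if `0 < x·x₀`, `0 < y·y₀` and `x₀·y₀ < 0` then `x·y < 0`. -/
theorem mul_neg_of_coherent {x x₀ y y₀ : ℝ} (hx : 0 < x * x₀) (hy : 0 < y * y₀) (h0 : x₀ * y₀ < 0) :
    x * y < 0 := by
  have h : 0 < (x * y) * (x₀ * y₀) := by nlinarith
  exact neg_of_mul_pos_left h h0.le

/-- **Main lemma.** `QuasiPencilBound C A (4n)` (the crux at fixed constants, size `4n`) bounds the number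
of strict sign alternations of `det G` along any increasing positive test sequence, for EVERY real
`n × n` lacunary pencil `G = Σ_l t^{d_l} A_l` with `d 0 = 0`, `d` strictly increasing (coefficients
arbitrary: no symmetry, no invertibility, no Rolle term). -/
theorem alternations_le_of_quasiPencilBound (C A n K : ℕ)
    (Acoef : Fin (K + 1) → Matrix (Fin n) (Fin n) ℝ) (d : Fin (K + 1) → ℕ) (hd0 : d 0 = 0)
    (hd : StrictMono d) (h : QuasiPencilBound C A ((n + n) + (n + n)))
    (N : ℕ) (τ : Fin (N + 1) → ℝ) (hτ : StrictMono τ) (hpos : ∀ j, 0 < τ j)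
    (halt : ∀ j : Fin N, (∑ l, τ j.castSucc ^ d l • Acoef l).det *
      (∑ l, τ j.succ ^ d l • Acoef l).det < 0) :
    N ≤ (K + 1) ^ (A * K) * 2 ^ (Nat.log 2 ((n + n) + (n + n)) + 2) ^ A := by
  rcases Nat.eq_zero_or_pos N with hN | hN
  · subst hN; exact Nat.zero_le _
  -- notation
  set G : Fin (N + 1) → Matrix (Fin n) (Fin n) ℝ := fun j => ∑ l, τ j ^ d l • Acoef l with hG
  set s : Fin (N + 1) → ℝ := fun j => ∑ l, τ j ^ d l with hs
  have hs_pos : ∀ j, 0 < s j := fun j =>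
    Finset.sum_pos (fun l _ => pow_pos (hpos j) _) Finset.univ_nonempty
  -- every test value of `det G` is nonzero
  have hGne : ∀ j, (G j).det ≠ 0 := by
    intro j
    rcases Fin.eq_castSucc_or_eq_last j with ⟨i, rfl⟩ | rfl
    · intro h0
      have h0' : (∑ l, τ i.castSucc ^ d l • Acoef l).det = 0 := h0
      have := halt i
      rw [h0', zero_mul] at this
      exact lt_irrefl _ this
    · obtain ⟨N', rfl⟩ : ∃ N', N = N' + 1 := ⟨N - 1, by omega⟩
      intro h0
      have h0' : (∑ l, τ (Fin.last N').succ ^ d l • Acoef l).det = 0 := by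
        rw [Fin.succ_last]; exact h0
      have := halt (Fin.last N')
      rw [h0', mul_zero] at this
      exact lt_irrefl _ this
  -- the perturbed determinants, as polynomial functions of `ε`
  set F : Fin (N + 1) → ℝ → ℝ := fun j ε => (G j).charpoly.eval ((ε * s j) ^ 2) with hF
  have hF0 : ∀ j, F j 0 = (-1) ^ n * (G j).det := by
    intro j
    simp only [hF, zero_mul, ne_eq, OfNat.ofNat_ne_zero, not_false_eq_true, zero_pow,
      Matrix.eval_charpoly, map_zero, zero_sub, Matrix.det_neg, Fintype.card_fin]
  have hFcont : ∀ j, Continuous (F j) := fun j =>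
    (Polynomial.continuous _).comp ((continuous_id.mul continuous_const).pow 2)
  -- eventually (ε → 0) every `F j ε` has the sign of `F j 0`
  have hev : ∀ᶠ ε in nhds (0 : ℝ), ∀ j, 0 < F j ε * F j 0 := by
    rw [Filter.eventually_all]
    intro j
    have hne0 : F j 0 ≠ 0 := by
      rw [hF0]; exact mul_ne_zero (pow_ne_zero _ (by norm_num)) (hGne j)
    have hcont : Continuous fun ε => F j ε * F j 0 := (hFcont j).mul continuous_const
    have hlim : Filter.Tendsto (fun ε => F j ε * F j 0) (nhds 0) (nhds (F j 0 * F j 0)) :=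
      hcont.tendsto 0
    exact hlim.eventually_const_lt (mul_self_pos.2 hne0)
  obtain ⟨r, hr, hball⟩ := Metric.eventually_nhds_iff.1 hev
  -- the finite bad set for `det T_0`
  set q : ℝ[X] := (Acoef 0).charpoly.comp (X ^ 2) with hq
  have hqne : q ≠ 0 :=
    ((Matrix.charpoly_monic (Acoef 0)).comp (monic_X_pow 2) (by simp)).ne_zero
  obtain ⟨ε, ⟨hε0, hεr⟩, hεq⟩ :=
    (Set.Ioo_infinite hr).exists_notMem_finset q.roots.toFinset
  have hε : ε ≠ 0 := hε0.ne'
  have hq_eval : (Acoef 0).charpoly.eval (ε ^ 2) ≠ 0 := by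
    intro h0
    apply hεq
    rw [Multiset.mem_toFinset, mem_roots hqne, IsRoot.def, hq, eval_comp, eval_pow, eval_X]
    exact h0
  have hsign : ∀ j, 0 < F j ε * F j 0 := hball (by simpa [Real.dist_eq, abs_lt] using ⟨by linarith, hεr⟩)
  -- the embedded pencil is in the triangular class
  set T := embT ε Acoef with hT
  have hT0 : (T 0).det ≠ 0 := by rw [hT, det_embT_zero ε hε]; exact hq_eval
  have htri : ∀ l : Fin K, (T l.succ).BlockTriangular id := fun l => embT_succ_blockTriangular ε Acoef l
  have hposT : ∀ (l : Fin K) (i : Fin (n + n)), 0 < T l.succ i i := by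
    intro l i; rw [hT, embT_succ_diag]; exact hε0
  have hup := triangular_quasiBound_of_quasiPencilBound C A (n + n) K T d hd0 hd hT0 htri hposT h
  -- its determinant alternates at the same test points
  have heval : ∀ j, ((∑ l, (X : ℝ[X]) ^ d l • (T l).map Polynomial.C).det).eval (τ j) = F j ε := by
    intro j
    have hne : ε * ∑ l, τ j ^ d l ≠ 0 := mul_ne_zero hε (hs_pos j).ne'
    rw [hT, eval_det_embT ε Acoef d hd0 (τ j) hne]
    simp only [hF, hG, hs, Matrix.eval_charpoly]
  have halt' : ∀ j : Fin N,
      ((∑ l, (X : ℝ[X]) ^ d l • (T l).map Polynomial.C).det).eval (τ j.castSucc) *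
        ((∑ l, (X : ℝ[X]) ^ d l • (T l).map Polynomial.C).det).eval (τ j.succ) < 0 := by
    intro j
    rw [heval, heval]
    refine mul_neg_of_coherent (hsign j.castSucc) (hsign j.succ) ?_
    rw [hF0, hF0]
    have hsq : ((-1 : ℝ) ^ n) * ((-1 : ℝ) ^ n) = 1 := by
      rw [← mul_pow]; simp
    have := halt j
    nlinarith [this, hsq]
  have hlow := le_card_posRoots_of_alternating _ N τ hτ hpos halt'
  exact hlow.trans hup

/-- **Packaged against the route decl.** The crux bounds the alternations of every real lacunary pencil
by its own budget at size `4n`. -/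
theorem generalPencil_alternations_le_of_derivedPencilRolleQuasi (h : DerivedPencilRolleQuasi) :
    ∃ A : ℕ, ∀ (n K : ℕ) (Acoef : Fin (K + 1) → Matrix (Fin n) (Fin n) ℝ) (d : Fin (K + 1) → ℕ),
      d 0 = 0 → StrictMono d → ∀ (N : ℕ) (τ : Fin (N + 1) → ℝ), StrictMono τ → (∀ j, 0 < τ j) →
      (∀ j : Fin N, (∑ l, τ j.castSucc ^ d l • Acoef l).det * (∑ l, τ j.succ ^ d l • Acoef l).det < 0) →
      N ≤ (K + 1) ^ (A * K) * 2 ^ (Nat.log 2 ((n + n) + (n + n)) + 2) ^ A := by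
  obtain ⟨C, A, hCA⟩ := derivedPencilRolleQuasi_iff.1 h
  exact ⟨A, fun n K Acoef d hd0 hd N τ hτ hpos halt =>
    alternations_le_of_quasiPencilBound C A n K Acoef d hd0 hd (hCA _) N τ hτ hpos halt⟩

/-- **H (the disprover's target; status OPEN).** Real square lacunary matrix pencils — ARBITRARY real
coefficient matrices, `d 0 = 0`, `d` strictly increasing — whose determinants have, for every exponent `A`,
more than `(K+1)^(A·K) · 2^((log₂(4n)+2)^A)` strict sign alternations along some increasing positive test
sequence.  Tropical instances = parametric assignment problems with `K+1` slope classes and sign-coherent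
unique optima (Viro lift); path-type (ABP) instances are capped at `2^{O(log² n)}` by Gusfield's bound and
cannot reach it, assignment-type instances are not known to be capped. [topic Computability/AlgebraicComplexity] -/
def GeneralPencilManyAlternations : Prop :=
  ∀ A : ℕ, ∃ (n K : ℕ) (Acoef : Fin (K + 1) → Matrix (Fin n) (Fin n) ℝ) (d : Fin (K + 1) → ℕ),
    d 0 = 0 ∧ StrictMono d ∧ ∃ (N : ℕ) (τ : Fin (N + 1) → ℝ), StrictMono τ ∧ (∀ j, 0 < τ j) ∧
      (∀ j : Fin N, (∑ l, τ j.castSucc ^ d l • Acoef l).det * (∑ l, τ j.succ ^ d l • Acoef l).det < 0) ∧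
      (K + 1) ^ (A * K) * 2 ^ (Nat.log 2 ((n + n) + (n + n)) + 2) ^ A < N

/-- **Kill criterion.** Any real lacunary pencil family with too many determinant sign alternations
refutes the crux. -/
theorem derivedPencilRolleQuasi_false_of_generalPencilManyAlternations
    (hH : GeneralPencilManyAlternations) : ¬ DerivedPencilRolleQuasi := by
  intro h
  obtain ⟨A, hA⟩ := generalPencil_alternations_le_of_derivedPencilRolleQuasi h
  obtain ⟨n, K, Acoef, d, hd0, hd, N, τ, hτ, hpos, halt, hlt⟩ := hH A
  exact absurd (hA n K Acoef d hd0 hd N τ hτ hpos halt) (not_le.2 hlt)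

end Summit.ValiantsHypothesis.ValiantsHypothesis.Theorems.DerivedPencilRolleQuasi.Negative
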